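import Literature.MathematicalPhysics.QuantumFieldTheory.Balaban1983to89.NodeOJetFamily

/-!
# `Balaban1983to89.NodeOJetAcross` — THE JET RECORD IS IMPLIED BY NODE O's WALK PACKAGE (one term), AND THE FAMILY LEVEL: the uniform jet
# statement `AcrossJet2` on a member set, its consumption `AcrossJet2 ⟹ AcrossOn216R` for the jet families, and `ExistsUniformAcrossSmall ⟹
# AcrossJet2` (T. Bałaban, CMP **116** (1988) [II] = [Balaban1988RG2Cluster] (2.16) p. 16, p. 15, Lemma 3 (2.38) p. 20; CMP **109** (1987)
# [I] = [Balaban1987RG1] (4.4) p. 281; CMP **99** (1985) [Balaban1985BackgroundPropagators] Thm 3.10 p. 416)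

statement-level skeleton of published theorems with citation tags; proofs where landed; nothing here is a claim about the Yang–Mills mass gap

CITATION HEADER (lean-in-tree rule).  Ideation cell `ym-nodeO-ideate` (portfolio track, 2026-08-25), seat P3 «weaken the target», memo
`memos/ROUTE-P3.md` v3.15 (sha256 756f0b72…) §2 row W-jet2, §9 nomination **N2**.  LANDING EDITION (generation 14), module 4 of N2 (last),
of the memo companion `memos/ROUTE-P3-SketchJet.lean` («JT», sha256 be2c53c0…, 794 l., 0 `sorry`, 0 `axiom`; referee REF g18 PASS
2026-08-25T17:49:30Z; director-ym LINE №2 (A)∕(B)): JT §5 :320–:400 (`A2_zero_zero`, **`jet216R_of_termWalkData`**) and §6 :403–:480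
(`jetTerms`, **`AcrossJet2`**, **`acrossOn216R_jet`**, **`acrossJet2_of_acrossSmall`**).  Statements and proofs below are CHARACTER-IDENTICAL
to JT's; edition deltas = the namespace (`YM.NodeO.P3.Jet` → this module's), this header, the import (module 3 `NodeOJetFamily`, which
carries JT's chains), the opens cut to the ones used, JT's `section JetFamily` + its two `variable` lines :174–:177 re-opened around §5
(§5 sat inside that section in JT), the CUT of JT §6's verbatim re-declaration `AcrossOn216R` :417 (module 2's, reached by `open`; JT's copy
took `{S : Type*}` from the section `variable`, T21c's ∕ module 2's binds it explicitly — the same declaration), and the companion's closing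
`#print axioms` lines dropped.  LABELS in the docstrings (memo-side words, NOT tree declarations): «NODE O» ∕ «(v)⁺» = :353
`B13TermWalkDataOneTorus.ExistsUniformAcrossSmall`; «NODE A» = `B13PrimitiveKernels216.h226_torus_of_kernelBounds`; «NODE B», «D.3»,
«(D4) wall», «E1», «SM `remainderConst_of_seam`» ∕ «`kcomap`», «TH `NET_β`», «T21c», «SK», «N1–N3» (NODE A's numerics in the memo),
«β-road», «(W-jet2|P)», «(W-216R|P)», «memo §2 row W-jet2» = memo ∕ companion labels, named only; «[II]» = [Balaban1988RG2Cluster]; «[I]» =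
[Balaban1987RG1]; «[B9]» = [Balaban1985BackgroundPropagators].

PRINT STATUS (LIT `lit/SOURCES.md` §1.1 ∕ §6).  PRINTED: the located bounds (2.16) p. 16 with the reference operators p. 15, Lemma 3 (2.38)
p. 20, the radius `α₂` of [I] (4.4) p. 281, [B9] Thm 3.10 p. 416.  NOT PRINTED AS SUCH: `AcrossJet2` (the uniform jet statement) — a typed
WEAKENING of the tree's NODE O statement (memo §2 row W-jet2), proved here to be implied by it (`acrossJet2_of_acrossSmall`, threshold factor
3) and to feed the (2.16)-level socket for the jet families (`acrossOn216R_jet`).  Proofs: Cauchy-estimate bookkeeping over the tree's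
`B13JointWalkExpansion` majorants and N1's jet calculus — [folklore] relative to those.

WHAT IS PROVED (sorry-free, axiom-free).
* §5 `A2_zero_zero` (`A(0,0) = C⁻¹`); **`jet216R_of_termWalkData`**: NODE O's one-term package `TermWalkData 𝒦 w`, `w` admissible at some
  `α ≥ 0`, gives the jet record with `K₁ = (K̄_Γ+K̄_E)∕R`, `K₂ = 4(K̄_Γ+K̄_E)∕R²` (Cauchy estimates on the `w.R`-ball, N1 `jet_budget_le` ∕
  `norm_fderiv_apply_le_of_ball`).
* §6 `jetTerms` (DATA), `AcrossJet2 𝓣 P α θ₀`; **`acrossOn216R_jet`** ((W-jet2|P) ⟹ module 2's `AcrossOn216R` for the jet images, jet budget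
  as the smallness); **`acrossJet2_of_acrossSmall`** (`ExistsUniformAcrossSmall 𝓣 α R_σ0 θ₀ ⟹ AcrossJet2 𝓣 univ α (3θ₀)`).

WHAT THIS IS NOT.  NOT an inhabitant of :353 or of `AcrossJet2` for Bałaban's kernels; NOT the identification of the jet objects with
Bałaban's ((J2)∕(J3), objects-side); NOT a change to NODE A; nothing of Bałaban's `C^{(k)}(Z₀,σ,u)`, `Γ_k(Z₀,σ)` is constructed or asserted;
no YM-PLAN ∕ Track-B node is claimed closed and no Track-B number is produced; not continuum, not mass gap, not Clay.  NEW file, imports built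
tree modules only; nothing modified.  Dimension-generic.  Net new unproved facts: 0.
[cite: Balaban1988RG2Cluster, (2.16) p.16, p.15, (2.38) p.20; Balaban1987RG1, (4.4) p.281; Balaban1985BackgroundPropagators, Thm 3.10 p.416] -/

noncomputable section

open Metric Set Filter
open scoped Topology

namespace Literature.MathematicalPhysics.QuantumFieldTheory.Balaban1983to89.NodeOJetAcross

open Literature.MathematicalPhysics.QuantumFieldTheory.Balaban1983to89.NodeOKernel216
open Literature.MathematicalPhysics.QuantumFieldTheory.Balaban1983to89.NodeOKernel216R
open Literature.MathematicalPhysics.QuantumFieldTheory.Balaban1983to89.NodeOJetCalculus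
open Literature.MathematicalPhysics.QuantumFieldTheory.Balaban1983to89.NodeOJetFamily
open Literature.MathematicalPhysics.QuantumFieldTheory.Balaban1983to89.TreeLengthTorus (TPt)
open Literature.MathematicalPhysics.QuantumFieldTheory.Balaban1983to89.B5TorusCover (UT)
open Literature.MathematicalPhysics.QuantumFieldTheory.Balaban1983to89.B9Thm37GlueTorus (tdist1)
open Literature.MathematicalPhysics.QuantumFieldTheory.Balaban1983to89.B13JointWalkExpansion (JointWalkExpansion WalkMajorants)
open Literature.MathematicalPhysics.QuantumFieldTheory.Balaban1983to89.B13TermWalkData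
open Literature.MathematicalPhysics.QuantumFieldTheory.Balaban1983to89.B13TermWalkDataOneTorus (SmallTheta ExistsUniformAcrossSmall)
open Literature.MathematicalPhysics.QuantumFieldTheory.Balaban1983to89.B12Decay510 (mixedDeriv)
open Literature.MathematicalPhysics.QuantumFieldTheory.Balaban1983to89.B12Decay510Holo
open Literature.Analysis.Complex

section JetFamily

variable {c : B13.Consts} {d N' ν : ℕ} {Nf : Fin ν → ℕ} [∀ i, NeZero (Nf i)]
variable {E : Type*} [NormedAddCommGroup E] [NormedSpace ℂ E]

/-! ## §5  IMPLIED BY NODE O: the walk package on the `w.R`-ball gives the jet record by Cauchy estimates at the base point -/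

/-- The reference precision identity `A(0,0) = C⁻¹` from `A(0,0)⁻¹ = C`, `C ≻ 0` (verbatim the computation inside SK
`Kernel216.of_termWalkData` :2618). [cite: Balaban1988RG2Cluster, p.15] -/
theorem A2_zero_zero (𝒦 : TermKernels c d N' ν Nf E) : 𝒦.A2 0 0 = 𝒦.C⁻¹.map (algebraMap ℝ ℂ) := by
  have hCu : IsUnit 𝒦.C.det := 𝒦.hC.det_pos.ne'.isUnit
  have hmul : 𝒦.C⁻¹.map (algebraMap ℝ ℂ) * 𝒦.C.map (algebraMap ℝ ℂ) = 1 := by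
    rw [← Matrix.map_mul, Matrix.nonsing_inv_mul 𝒦.C hCu, Matrix.map_one _ (map_zero _) (map_one _)]
  have hCmu : IsUnit (𝒦.C.map (algebraMap ℝ ℂ)) :=
    (Matrix.isUnit_iff_isUnit_det _).2 (Matrix.isUnit_det_of_left_inverse hmul)
  have hAu : IsUnit (𝒦.A2 0 0).det := by
    rw [← Matrix.isUnit_iff_isUnit_det, ← Matrix.isUnit_nonsing_inv_iff, 𝒦.hC0]; exact hCmu
  rw [← Matrix.nonsing_inv_nonsing_inv (𝒦.A2 0 0) hAu, 𝒦.hC0]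
  exact Matrix.inv_eq_left_inv hmul

/-- **NODE O's PACKAGE ⟹ THE JET RECORD** (one term): from `TermWalkData 𝒦 w` with `w` admissible at some `α ≥ 0` —
references from the majorants at `(0,0)` (`G(0,0) = Γ₀`, `A(0,0)⁻¹ = C`); the σ-part at `u = 0` from `sub_ref_sigma`
(`θ⁰_• = 2K̄_•e^{−εR_σ}`, NO `α∕R` term); the germ from `analyticOnBall` (radius `w.R`); the derivative letters by the
CAUCHY ESTIMATES on the `w.R`-ball: `K₁ = (K̄_Γ + K̄_E)∕R` (§1 `norm_fderiv_apply_le_of_ball`) and `K₂ = 4(K̄_Γ + K̄_E)∕R²`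
(tree `B12Decay510Holo.norm_mixedDeriv_le_of_differentiableOn` — the wall's own Cauchy lemma, run on the KERNEL entries).
So the «bigger analyticity space» is, on the β-road, a device producing derivative letters of size `K̄∕R`.
[cite: Balaban1988RG2Cluster, p.13, p.15, (2.16) p.16; Balaban1985BackgroundPropagators, Thm 3.10 p.416; Balaban1987RG1, (4.5) p.282] -/
theorem jet216R_of_termWalkData {𝒦 : TermKernels c d N' ν Nf E} {w : WalkConsts} {α Rσ₀ : ℝ} (hw : w.Admissible α Rσ₀)
    (hα : 0 ≤ α) (h : TermWalkData 𝒦 w) :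
    Jet216R 𝒦 w.kap w.KbarΓ w.KbarC (2 * w.KbarΓ * Real.exp (-(w.ε * w.Rσ))) (2 * w.KbarE * Real.exp (-(w.ε * w.Rσ)))
      ((w.KbarΓ + w.KbarE) / w.R) (4 * (w.KbarΓ + w.KbarE) / w.R ^ 2) := by
  obtain ⟨WΓ, TΓ, SXΓ, AΓ, DΓ, ρΓ, hΓ⟩ := h.hΓ
  obtain ⟨WE, TE, SXE, AE, DE, ρE, hE⟩ := h.hE
  obtain ⟨WC, TC, AC, DC, ρC, hC⟩ := h.hCov
  have hR : 0 < w.R := hα.trans_lt hw.hαR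
  have h0σ : ∀ j, ‖(0 : TPt d N' → ℂ) j‖ ≤ Real.exp c.κ₁ := fun _ => by
    rw [Pi.zero_apply, norm_zero]; exact (Real.exp_pos _).le
  have h00 : (0 : E) ∈ ball (0 : E) w.R := mem_ball_self hR
  have hKΓE : w.KbarΓ ≤ w.KbarΓ + w.KbarE := le_add_of_nonneg_right hw.hKbarE
  have hKEΓ : w.KbarE ≤ w.KbarΓ + w.KbarE := le_add_of_nonneg_left hw.hKbarΓ
  refine ⟨fun b j => ?_, fun b b' => ?_, fun σ hσ b j => ?_, fun σ hσ b b' => ?_,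
    ⟨w.R, hR, hE.analyticOnBall hw.hε, hΓ.analyticOnBall hw.hε⟩,
    fun σ hσ b j v => ?_, fun σ hσ b j v u => ?_, fun σ hσ b b' v => ?_, fun σ hσ b b' v u => ?_⟩
  · -- reference Γ₀ from the Γ-majorant at (0,0)
    have h1 := hΓ.majorants hw.hε 0 h0σ 0 h00 b j
    rwa [𝒦.hG0, Matrix.map_apply, Complex.coe_algebraMap, Complex.norm_real] at h1
  · -- reference C from the covariance majorant at (0,0)
    have h1 := hC.majorants 0 h0σ 0 h00 b b'
    rwa [𝒦.hC0, Matrix.map_apply, Complex.coe_algebraMap, Complex.norm_real] at h1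
  · -- σ-part for Γ at u = 0
    have h1 := hΓ.sub_ref_sigma hR hw.hε h.hfar σ hσ b j
    rwa [𝒦.hG0] at h1
  · -- σ-part for the precision at u = 0
    have h1 := hE.sub_ref_sigma hR hw.hε h.hfar σ hσ b b'
    rwa [A2_zero_zero 𝒦] at h1
  · -- first u-derivative of a Γ-entry at 0: Cauchy on the R-ball
    have key := norm_fderiv_apply_le_of_ball hR (hΓ.analyticOnBall hw.hε σ hσ b j)
      (fun u hu => hΓ.majorants hw.hε σ hσ u hu b j) v
    refine key.trans (mul_le_mul_of_nonneg_right ?_ (norm_nonneg _))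
    rw [div_mul_eq_mul_div]
    exact div_le_div_of_nonneg_right (mul_le_mul_of_nonneg_right hKΓE (Real.exp_pos _).le) hR.le
  · -- mixed second u-derivative of a Γ-entry at 0: the wall's Cauchy lemma on the kernel entry
    have key := norm_mixedDeriv_le_of_differentiableOn hR (hΓ.analyticOnBall hw.hε σ hσ b j)
      (fun u hu => hΓ.majorants hw.hε σ hσ u hu b j) v u
    refine key.trans ?_
    have hfac : 4 * (w.KbarΓ * Real.exp (-(w.kap * tdist1 Nf (𝒦.locΛ b) (𝒦.locN j)))) / w.R ^ 2
        ≤ 4 * (w.KbarΓ + w.KbarE) / w.R ^ 2 * Real.exp (-(w.kap * tdist1 Nf (𝒦.locΛ b) (𝒦.locN j))) := by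
      rw [show 4 * (w.KbarΓ + w.KbarE) / w.R ^ 2 * Real.exp (-(w.kap * tdist1 Nf (𝒦.locΛ b) (𝒦.locN j)))
          = 4 * ((w.KbarΓ + w.KbarE) * Real.exp (-(w.kap * tdist1 Nf (𝒦.locΛ b) (𝒦.locN j)))) / w.R ^ 2 by ring]
      gcongr
    exact mul_le_mul_of_nonneg_right (mul_le_mul_of_nonneg_right hfac (norm_nonneg _)) (norm_nonneg _)
  · have key := norm_fderiv_apply_le_of_ball hR (hE.analyticOnBall hw.hε σ hσ b b')
      (fun u hu => hE.majorants hw.hε σ hσ u hu b b') v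
    refine key.trans (mul_le_mul_of_nonneg_right ?_ (norm_nonneg _))
    rw [div_mul_eq_mul_div]
    exact div_le_div_of_nonneg_right (mul_le_mul_of_nonneg_right hKEΓ (Real.exp_pos _).le) hR.le
  · have key := norm_mixedDeriv_le_of_differentiableOn hR (hE.analyticOnBall hw.hε σ hσ b b')
      (fun u hu => hE.majorants hw.hε σ hσ u hu b b') v u
    refine key.trans ?_
    have hfac : 4 * (w.KbarE * Real.exp (-(w.kap * tdist1 Nf (𝒦.locΛ b) (𝒦.locΛ b')))) / w.R ^ 2
        ≤ 4 * (w.KbarΓ + w.KbarE) / w.R ^ 2 * Real.exp (-(w.kap * tdist1 Nf (𝒦.locΛ b) (𝒦.locΛ b'))) := by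
      rw [show 4 * (w.KbarΓ + w.KbarE) / w.R ^ 2 * Real.exp (-(w.kap * tdist1 Nf (𝒦.locΛ b) (𝒦.locΛ b')))
          = 4 * ((w.KbarΓ + w.KbarE) * Real.exp (-(w.kap * tdist1 Nf (𝒦.locΛ b) (𝒦.locΛ b')))) / w.R ^ 2 by ring]
      gcongr
    exact mul_le_mul_of_nonneg_right (mul_le_mul_of_nonneg_right hfac (norm_nonneg _)) (norm_nonneg _)

end JetFamily

/-! ## §6  THE FAMILY LEVEL: the uniform jet statement, its consumption on any member set, and (v)⁺ ⟹ it -/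

section Family

variable {c : B13.Consts} {d : ℕ} {S : Type*}

/-- The jet image of a member: same torus, configuration space and term index; every term replaced by its jet family.
DATA. [cite: Balaban1988RG2Cluster, p.13, p.15] -/
def jetTerms (𝓣 : TorusTerms c d) : TorusTerms c d :=
  { 𝓣 with 𝒦 := fun i => kjet (𝓣.𝒦 i) }

/-- (W-jet2|P) **THE UNIFORM JET STATEMENT ON A MEMBER SET `P`, FOR USE AT RADIUS `α` WITH THRESHOLD `θ₀`**: common letters
`κ > 0`, `K_Γ, K₀, θ⁰_Γ, θ⁰_E, K₁, K₂ ≥ 0` with the JET BUDGET `θ⁰_• + K₁α + ½K₂α² ≤ θ₀`, such that every term of every member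
of `P` satisfies the jet record.  The body evaluates no kernel at any configuration `u ≠ 0` (only the germ clause mentions a
neighbourhood, with no letter); `α` enters through the budget alone.  On the β-road: `α = α₂` of (4.4), `P` = the law class ×
cofinal tori (TH `NET_β`), after the seam pull-back (SM `kcomap`) if wanted. [cite: Balaban1988RG2Cluster, (2.16) p.16, p.15;
Balaban1987RG1, (4.4) p.281, (1.22) p.264] -/
def AcrossJet2 (𝓣 : S → TorusTerms c d) (P : Set S) (α θ₀ : ℝ) : Prop :=
  ∃ kap KΓ K₀ θΓ θE K₁ K₂ : ℝ, 0 < kap ∧ 0 ≤ KΓ ∧ 0 ≤ K₀ ∧ 0 ≤ θΓ ∧ 0 ≤ θE ∧ 0 ≤ K₁ ∧ 0 ≤ K₂ ∧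
    θΓ + (K₁ * α + 1 / 2 * K₂ * α ^ 2) ≤ θ₀ ∧ θE + (K₁ * α + 1 / 2 * K₂ * α ^ 2) ≤ θ₀ ∧
    ∀ s ∈ P, ∀ i : (𝓣 s).ι, Jet216R ((𝓣 s).𝒦 i) kap KΓ K₀ θΓ θE K₁ K₂

/-- **(W-jet2|P) at `(α, θ₀)` ⟹ (W-216R|P) at `(α, θ₀)` FOR THE JET FAMILIES** (`0 ≤ α`): the (2.16)-level socket of E1 —
hence NODE A's inputs at every configuration of the `α`-ball, NODE B, D.3 and the (D4) wall (SM `remainderConst_of_seam`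
:593, `H` := the jet objects' activities) — is met by the jet image of every member of `P`, with the jet budget as the
smallness. [cite: Balaban1988RG2Cluster, (2.16) p.16, p.15, Lemma 3 (2.38) p.20; Balaban1987RG1, (4.4) p.281] -/
theorem acrossOn216R_jet {𝓣 : S → TorusTerms c d} {P : Set S} {α θ₀ : ℝ} (hα : 0 ≤ α) (h : AcrossJet2 𝓣 P α θ₀) :
    AcrossOn216R (fun s => jetTerms (𝓣 s)) P α θ₀ := by
  obtain ⟨kap, KΓ, K₀, θΓ, θE, K₁, K₂, hkap, hKΓ, hK₀, hθΓ, hθE, hK₁, hK₂, hbΓ, hbE, hall⟩ := h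
  have hb : 0 ≤ K₁ * α + 1 / 2 * K₂ * α ^ 2 := by positivity
  exact ⟨kap, KΓ, K₀, θΓ + (K₁ * α + 1 / 2 * K₂ * α ^ 2), θE + (K₁ * α + 1 / 2 * K₂ * α ^ 2), hkap, hKΓ, hK₀,
    add_nonneg hθΓ hb, add_nonneg hθE hb, hbΓ, hbE, fun s hs i => (hall s hs i).kernel216R_kjet hK₁ hK₂ α⟩

/-- **NODE O AS TYPED ⟹ THE UNIFORM JET STATEMENT, on ALL members, at `(α, 3θ₀)`**: (v)⁺ = `ExistsUniformAcrossSmall 𝓣 α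
R_σ0 θ₀` gives, by §5 per term with the common package `w`, the jet letters `K₁ = (K̄_Γ+K̄_E)∕R`, `K₂ = 4(K̄_Γ+K̄_E)∕R²`, and
`SmallTheta` (`2K̄_•(e^{−εR_σ} + α∕R) ≤ θ₀`, `α < R`) bounds the jet budget: `θ⁰_• + K₁α + ½K₂α² ≤ 3θ₀`.  So the jet
statement is IMPLIED by NODE O (up to the numerical factor 3 in the threshold, absorbed by NODE A's numerics N1–N3 like every
threshold in this memo) — and it is strictly weaker (memo §2 row W-jet2: cubic background dependence has zero jet letters and
no small `θ` on any ball). [cite: Balaban1988RG2Cluster, p.15, (2.16) p.16; Balaban1985BackgroundPropagators, Thm 3.10 p.416] -/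
theorem acrossJet2_of_acrossSmall {𝓣 : S → TorusTerms c d} {α Rσ₀ θ₀ : ℝ} (hα : 0 ≤ α)
    (h : ExistsUniformAcrossSmall 𝓣 α Rσ₀ θ₀) : AcrossJet2 𝓣 Set.univ α (3 * θ₀) := by
  obtain ⟨w, hw, hs, hall⟩ := h
  have hR : 0 < w.R := hα.trans_lt hw.hαR
  have he : 0 < Real.exp (-(w.ε * w.Rσ)) := Real.exp_pos _
  have hKΓ := hw.hKbarΓ
  have hKE := hw.hKbarE
  -- the ratio t = α ∕ R ∈ [0, 1)
  have ht0 : 0 ≤ α / w.R := div_nonneg hα hR.le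
  have ht1 : α / w.R ≤ 1 := ((div_lt_one hR).2 hw.hαR).le
  have ht2 : (α / w.R) ^ 2 ≤ α / w.R := by nlinarith
  -- SmallTheta, multiplied out
  have hΓ' : 2 * w.KbarΓ * Real.exp (-(w.ε * w.Rσ)) + 2 * w.KbarΓ * (α / w.R) ≤ θ₀ := by
    have := hs.hΓ; rwa [mul_add] at this
  have hE' : 2 * w.KbarE * Real.exp (-(w.ε * w.Rσ)) + 2 * w.KbarE * (α / w.R) ≤ θ₀ := by
    have := hs.hE; rwa [mul_add] at this
  -- the jet budget in terms of t
  have hbud : (w.KbarΓ + w.KbarE) / w.R * α + 1 / 2 * (4 * (w.KbarΓ + w.KbarE) / w.R ^ 2) * α ^ 2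
      = (w.KbarΓ + w.KbarE) * (α / w.R) + 2 * (w.KbarΓ + w.KbarE) * (α / w.R) ^ 2 := by
    field_simp
    ring
  have hsq : (w.KbarΓ + w.KbarE) * (α / w.R) ^ 2 ≤ (w.KbarΓ + w.KbarE) * (α / w.R) :=
    mul_le_mul_of_nonneg_left ht2 (add_nonneg hKΓ hKE)
  have heΓ : 0 ≤ w.KbarΓ * Real.exp (-(w.ε * w.Rσ)) := mul_nonneg hKΓ he.le
  have heE : 0 ≤ w.KbarE * Real.exp (-(w.ε * w.Rσ)) := mul_nonneg hKE he.le
  refine ⟨w.kap, w.KbarΓ, w.KbarC, 2 * w.KbarΓ * Real.exp (-(w.ε * w.Rσ)), 2 * w.KbarE * Real.exp (-(w.ε * w.Rσ)),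
    (w.KbarΓ + w.KbarE) / w.R, 4 * (w.KbarΓ + w.KbarE) / w.R ^ 2, hw.hkap, hKΓ, hw.hKbarC,
    by positivity, by positivity, by positivity, by positivity, ?_, ?_, fun s _ i => jet216R_of_termWalkData hw hα (hall s i)⟩
  · rw [hbud]; nlinarith [hΓ', hE', hsq, heΓ, heE]
  · rw [hbud]; nlinarith [hΓ', hE', hsq, heΓ, heE]

end Family

end Literature.MathematicalPhysics.QuantumFieldTheory.Balaban1983to89.NodeOJetAcross

end
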